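import Summits.AtomisticToContinuum.HydrodynamicLimit.Theorems.CollisionIsometryCLTAdaptedWeightCLTSAWindowMeasurable

/-!
# Stub `stub_windowOfUI` of the line `sustained-anisotropy-superexp`, helper 3/4: the estimate along a good orbit
(crux `CollisionIsometryCLT.AdaptedWeightCLT`, stmt-AtomisticToContinuum-14868; `--supports`)

The DETERMINISTIC part of `stub_windowOfUI`, for one good datum `z` of the hard-sphere flow `Φ N`:
* UI WITH A VELOCITY CUT-OFF (`cellF_le_affine`): the uniform-integrability bound
  `∫ₓ cellA ≤ K₁ (N+1)⁻¹ Σ_j (1 + |v_j|⁶)` (`CellUIBound`, a hypothesis of the stub) and the cut-off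
  `|v|⁶ ≤ V⁶ + fastPow 6 V v ≤ V⁶ + 6!/(λV)⁶ e^{λ|v|²}` (`PastDamping.norm_pow_le_add_fastPow`, `avg_fastPow_le`) give
  the pointwise affine bound `f(s) ≤ A + β M(s)` along the orbit, `f(s) = ∫ₓ cellA(Φ_s z, x)`,
  `M(s) = expMoment λ (Φ_s z)`, `A = cA K₁ V = K₁(1 + V⁶)`, `β = cβ K₁ λ V = K₁ · 6!/(λV)⁶`;
* `f` and `M` are measurable in `s` (through `measurable_cellF`, `measurable_expMoment` and the measurable orbit
  `Reduction.measurable_flow_of_mem_good`), nonnegative, and bounded (energy conservation,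
  `Reduction.norm_vel_flow_le`), so the deterministic window estimate `WindowOfUI.integral_le_of_windows` applies
  with the measurable set `E = {t' | (t', z) ∈ susMod ∪ iprBad}` (a section of the jointly measurable events of
  the previous file; on the good set these ARE the line's events): `cellInt_le_orbit`;
* generic pieces of the probabilistic step of the last file: dominated convergence on `[0, t]` for integrands
  `≤ 1` (`tendsto_setLIntegral_of_le_one`), Markov for the window ipr at a fixed window end (`measure_ipr_gt_le`),
  and the choice of the cut-off `V` (`3 β C' ≤ κ/8`, `exists_cutoff`) and of the tail cap `Cw` (`A C'/Cw ≤ κ/8`,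
  `exists_tailCap`).
Registered anchor: `windowOfUI_orbit_anchor` (= `expMoment_flow_le`).
-/

namespace Summit.AtomisticToContinuum.HydrodynamicLimit.Theorems.SustainedAnisotropy

open scoped BigOperators Topology Classical MeasureTheory ENNReal InnerProductSpace
open Filter Set MeasureTheory
open Literature.Analysis.FluidPDE
open Summit.AtomisticToContinuum.HydrodynamicLimit.Theorems.ContactSourceDuhamel
open Summit.AtomisticToContinuum.HydrodynamicLimit.Theorems.ContactSourceDuhamel.TimeLocal
open Summit.AtomisticToContinuum.HydrodynamicLimit.Theorems.ContactBalance
open Literature.MathematicalPhysics.KineticTheory (hsDiameter hsDiameter_le localGibbsLaw empiricalDensityField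
  empiricalMomentumField)

noncomputable section

namespace WindowOfUI

variable {σ : ℝ} {N : ℕ}

/-! ## The constants of the velocity cut-off -/

/-- The constant part `A = K₁ (1 + V⁶)` of the cut-off bound. -/
def cA (K₁ V : ℝ) : ℝ := K₁ * (1 + V ^ 6)

/-- The exponential-moment coefficient `β = K₁ · 6!/(λV)⁶` of the cut-off bound (`→ 0` as `V → ∞`). -/
def cβ (K₁ lam V : ℝ) : ℝ := K₁ * ((((6 : ℕ).factorial : ℕ) : ℝ) / (lam * V) ^ 6)

/-- `cA ≥ 0` for `K₁ ≥ 0`. -/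
theorem cA_nonneg {K₁ : ℝ} (hK₁ : 0 ≤ K₁) (V : ℝ) : 0 ≤ cA K₁ V := by
  unfold cA
  positivity

/-- `cβ ≥ 0` for `K₁ ≥ 0`, `λ, V > 0`. -/
theorem cβ_nonneg {K₁ lam V : ℝ} (hK₁ : 0 ≤ K₁) (hlam : 0 < lam) (hV : 0 < V) : 0 ≤ cβ K₁ lam V := by
  unfold cβ
  positivity

/-- `cβ K₁ λ V → 0` as `V → ∞`. -/
theorem tendsto_cβ (K₁ : ℝ) {lam : ℝ} (hlam : 0 < lam) :
    Tendsto (fun V : ℝ => cβ K₁ lam V) atTop (𝓝 0) := by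
  have h1 : Tendsto (fun V : ℝ => (lam * V) ^ 6) atTop atTop :=
    (tendsto_pow_atTop (by norm_num)).comp (tendsto_id.const_mul_atTop hlam)
  have h2 : Tendsto (fun V : ℝ => (((6 : ℕ).factorial : ℕ) : ℝ) / (lam * V) ^ 6) atTop (𝓝 0) :=
    tendsto_const_nhds.div_atTop h1
  have h3 := h2.const_mul K₁
  rw [mul_zero] at h3
  exact h3

/-! ## UI with a velocity cut-off -/

/-- The sixth velocity moment of the empirical measure against the exponential moment:
`(N+1)⁻¹ Σ_j (1 + |v_j|⁶) ≤ 1 + V⁶ + 6!/(λV)⁶ · expMoment λ`. -/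
theorem avg_one_add_pow_six_le {lam V : ℝ} (hlam : 0 < lam) (hV : 0 < V) (z : Cfg N) :
    ((N + 1 : ℕ) : ℝ)⁻¹ * ∑ j : Fin (N + 1), (1 + ‖(z j).2‖ ^ 6) ≤
      1 + V ^ 6 + (((6 : ℕ).factorial : ℕ) : ℝ) / (lam * V) ^ 6 * PastDamping.expMoment lam N z := by
  have hN : (0 : ℝ) < ((N + 1 : ℕ) : ℝ) := by positivity
  have h1 : ∑ j : Fin (N + 1), (1 + ‖(z j).2‖ ^ 6) ≤
      ∑ j : Fin (N + 1), ((1 + V ^ 6) + PastDamping.fastPow 6 V (z j).2) :=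
    Finset.sum_le_sum fun j _ => by linarith [PastDamping.norm_pow_le_add_fastPow hV.le 6 (z j).2]
  have h1' : ∑ j : Fin (N + 1), ((1 + V ^ 6) + PastDamping.fastPow 6 V (z j).2) =
      ((N + 1 : ℕ) : ℝ) * (1 + V ^ 6) + ∑ j : Fin (N + 1), PastDamping.fastPow 6 V (z j).2 := by
    rw [Finset.sum_add_distrib, Finset.sum_const, Finset.card_univ, Fintype.card_fin, nsmul_eq_mul]
  rw [h1'] at h1
  have h2 := PastDamping.avg_fastPow_le hlam hV 6 z
  calc ((N + 1 : ℕ) : ℝ)⁻¹ * ∑ j : Fin (N + 1), (1 + ‖(z j).2‖ ^ 6)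
      ≤ ((N + 1 : ℕ) : ℝ)⁻¹ * (((N + 1 : ℕ) : ℝ) * (1 + V ^ 6) +
          ∑ j : Fin (N + 1), PastDamping.fastPow 6 V (z j).2) :=
        mul_le_mul_of_nonneg_left h1 (inv_nonneg.2 hN.le)
    _ = (1 + V ^ 6) + ((N + 1 : ℕ) : ℝ)⁻¹ * ∑ j : Fin (N + 1), PastDamping.fastPow 6 V (z j).2 := by
        rw [mul_add, ← mul_assoc, inv_mul_cancel₀ hN.ne', one_mul]
    _ ≤ _ := by linarith [h2]

/-- **UI with a cut-off.** If `∫ₓ cellA(z', x) ≤ K₁ (N+1)⁻¹ Σ_j (1 + |v_j|⁶)` with `K₁ ≥ 0`, then for every cut-off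
`V > 0` and rate `λ > 0`: `cellF z' ≤ cA K₁ V + cβ K₁ λ V · expMoment λ z'`. -/
theorem cellF_le_affine {φ ψ : ℕ → T3 → ℝ} {K₁ : ℝ} (hK₁ : 0 ≤ K₁) {z' : Cfg N}
    (hUI : cellF N φ ψ z' ≤ K₁ * (((N + 1 : ℕ) : ℝ)⁻¹ * ∑ j : Fin (N + 1), (1 + ‖(z' j).2‖ ^ 6)))
    {lam V : ℝ} (hlam : 0 < lam) (hV : 0 < V) :
    cellF N φ ψ z' ≤ cA K₁ V + cβ K₁ lam V * PastDamping.expMoment lam N z' := by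
  have h := mul_le_mul_of_nonneg_left (avg_one_add_pow_six_le hlam hV z') hK₁
  unfold cA cβ
  linarith [hUI, h]

/-! ## Along a good orbit -/

section Orbit

variable (Φ : Flow σ N) {z : Cfg N}

/-- The exponential moment along a good orbit is bounded (energy conservation): `M(s) ≤ e^{λ vR(z)²}`. -/
theorem expMoment_flow_le (hz : z ∈ Φ.good) {lam : ℝ} (hlam : 0 ≤ lam) (s : ℝ) :
    PastDamping.expMoment lam N (Φ.flow s z) ≤ Real.exp (lam * Reduction.vR z ^ 2) := by
  have h : ∀ i, Real.exp (lam * ‖(Φ.flow s z i).2‖ ^ 2) ≤ Real.exp (lam * Reduction.vR z ^ 2) := fun i =>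
    Real.exp_le_exp.2 (mul_le_mul_of_nonneg_left
      (pow_le_pow_left₀ (norm_nonneg _) (Reduction.norm_vel_flow_le Φ hz s i) 2) hlam)
  have h2 := Reduction.abs_avg_le (fun i => Real.exp (lam * ‖(Φ.flow s z i).2‖ ^ 2))
    (B := Real.exp (lam * Reduction.vR z ^ 2)) (fun i => by rw [abs_of_nonneg (Real.exp_pos _).le]; exact h i)
  unfold PastDamping.expMoment
  exact (le_abs_self _).trans h2

/-- The exponential moment along a good orbit is measurable in time. -/
theorem measurable_expMoment_flow (hz : z ∈ Φ.good) (lam : ℝ) :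
    Measurable fun s : ℝ => PastDamping.expMoment lam N (Φ.flow s z) :=
  (measurable_expMoment lam).comp (Reduction.measurable_flow_of_mem_good Φ hz)

/-- The space-integrated cell anisotropy along a good orbit is measurable in time. -/
theorem measurable_cellF_flow (hz : z ∈ Φ.good) {φ ψ : ℕ → T3 → ℝ} (hφc : Continuous (φ N))
    (hψc : Continuous (ψ N)) : Measurable fun s : ℝ => cellF N φ ψ (Φ.flow s z) :=
  (measurable_cellF hφc hψc).comp (Reduction.measurable_flow_of_mem_good Φ hz)

end Orbit

/-- On a good orbit the window integrals of the previous file are the plain window integrals. -/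
theorem winCellF_eq_of_mem (Φ : Flows σ) {z : Cfg N} (hz : z ∈ (Φ N).good) (φ ψ : ℕ → T3 → ℝ) (Δ t' : ℝ) :
    winCellF Φ N φ ψ Δ t' z = ∫ s in Icc (t' - Δ) t', cellF N φ ψ ((Φ N).flow s z) := by
  unfold winCellF
  simp only [fmod_of_mem Φ hz]

/-- On a good orbit the window exponential moments of the previous file are the plain window integrals. -/
theorem winExpF_eq_of_mem (Φ : Flows σ) {z : Cfg N} (hz : z ∈ (Φ N).good) (lam Δ t' : ℝ) :
    winExpF Φ N lam Δ t' z = ∫ s in Icc (t' - Δ) t', PastDamping.expMoment lam N ((Φ N).flow s z) := by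
  unfold winExpF
  simp only [fmod_of_mem Φ hz]

/-- **The deterministic estimate along a good orbit.** For a good datum `z` whose orbit satisfies the UI bound
(`N ≥ N₀` of `CellUIBound`; good orbits stay in the hard-sphere domain) and the exponential-moment budget
`∫_{[0,t]} M ≤ C'`, for a window `0 < Δ ≤ t`, a level `a ≥ 0`, a tail cap `Cw > 0` and any `ε`:
`CellInt ≤ a t + A (2Δ + C'/Cw) + 3 β C' + (A + β Cw) · λ{t' ∈ [Δ, t] | (t', z) ∈ susMod ∪ iprBad}`. -/
theorem cellInt_le_orbit (Φ : Flows σ) (hG : (Torus.geometry (Fin 3)).IsHardSphereRegular (hsDiameter σ N))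
    {φ ψ : ℕ → T3 → ℝ} (hφc : Continuous (φ N)) (hψc : Continuous (ψ N)) {K₁ : ℝ} (hK₁ : 0 ≤ K₁)
    (hUI : ∀ z' ∈ hardSphereDomain (Torus.geometry (Fin 3)) (N + 1) (hsDiameter σ N),
      cellF N φ ψ z' ≤ K₁ * (((N + 1 : ℕ) : ℝ)⁻¹ * ∑ j : Fin (N + 1), (1 + ‖(z' j).2‖ ^ 6)))
    {lam V : ℝ} (hlam : 0 < lam) (hV : 0 < V) {Δ t : ℝ} (hΔ : 0 < Δ) (hΔt : Δ ≤ t)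
    {z : Cfg N} (hz : z ∈ (Φ N).good) {C' : ℝ}
    (hM : ∫ s in Icc 0 t, PastDamping.expMoment lam N ((Φ N).flow s z) ≤ C')
    {a ε Cw : ℝ} (ha : 0 ≤ a) (hCw : 0 < Cw) :
    CellInt σ N (Φ N) φ ψ t z ≤ a * t + cA K₁ V * (2 * Δ + C' / Cw) + 3 * cβ K₁ lam V * C' +
      (cA K₁ V + cβ K₁ lam V * Cw) *
        volume.real ({t' : ℝ | (t', z) ∈ susMod Φ N φ ψ Δ a ε lam Cw ∪ iprBad Φ N Δ ε} ∩ Icc Δ t) := by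
  -- the two functions of time along the orbit
  have hh : Measurable fun s : ℝ => cellF N φ ψ ((Φ N).flow s z) := measurable_cellF_flow (Φ N) hz hφc hψc
  have hm : Measurable fun s : ℝ => PastDamping.expMoment lam N ((Φ N).flow s z) :=
    measurable_expMoment_flow (Φ N) hz lam
  have h0 : ∀ s, 0 ≤ cellF N φ ψ ((Φ N).flow s z) := fun s => cellF_nonneg N φ ψ _
  have m0 : ∀ s, 0 ≤ PastDamping.expMoment lam N ((Φ N).flow s z) := fun s =>
    PastDamping.expMoment_nonneg lam N _
  -- the affine bound (UI with cut-off; good orbits stay in the domain)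
  have hAm : ∀ s, cellF N φ ψ ((Φ N).flow s z) ≤
      cA K₁ V + cβ K₁ lam V * PastDamping.expMoment lam N ((Φ N).flow s z) := fun s =>
    cellF_le_affine hK₁ (hUI _ (((Φ N).isTrajectory z hz).mem s)) hlam hV
  -- bounds
  have hA := cA_nonneg hK₁ V
  have hβ := cβ_nonneg hK₁ hlam hV
  set B : ℝ := max (cA K₁ V + cβ K₁ lam V * Real.exp (lam * Reduction.vR z ^ 2))
    (Real.exp (lam * Reduction.vR z ^ 2)) with hB
  have hmB : ∀ s, PastDamping.expMoment lam N ((Φ N).flow s z) ≤ B := fun s =>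
    (expMoment_flow_le (Φ N) hz hlam.le s).trans (le_max_right _ _)
  have hhB : ∀ s, cellF N φ ψ ((Φ N).flow s z) ≤ B := fun s =>
    ((hAm s).trans (add_le_add le_rfl (mul_le_mul_of_nonneg_left
      (expMoment_flow_le (Φ N) hz hlam.le s) hβ))).trans (le_max_left _ _)
  -- the measurable set of bad window ends
  have hS : MeasurableSet (susMod Φ N φ ψ Δ a ε lam Cw ∪ iprBad Φ N Δ ε) :=
    (measurableSet_susMod Φ hG hφc hψc Δ a ε lam Cw).union (measurableSet_iprBad Φ hG Δ ε)
  have hE : MeasurableSet {t' : ℝ | (t', z) ∈ susMod Φ N φ ψ Δ a ε lam Cw ∪ iprBad Φ N Δ ε} :=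
    measurableSet_section_left hS z
  have hwin : ∀ t' ∈ Icc Δ t, a ≤ Δ⁻¹ * ∫ s in Icc (t' - Δ) t', cellF N φ ψ ((Φ N).flow s z) →
      Δ⁻¹ * ∫ s in Icc (t' - Δ) t', PastDamping.expMoment lam N ((Φ N).flow s z) ≤ Cw →
        t' ∈ {t' : ℝ | (t', z) ∈ susMod Φ N φ ψ Δ a ε lam Cw ∪ iprBad Φ N Δ ε} := by
    intro t' _ h1 h2
    rw [← winCellF_eq_of_mem Φ hz] at h1
    rw [← winExpF_eq_of_mem Φ hz] at h2
    simp only [mem_setOf_eq, mem_union, susMod, iprBad]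
    by_cases hip : iprMod Φ N Δ t' z ≤ ε
    · exact Or.inl ⟨h1, hip, h2⟩
    · exact Or.inr (not_le.1 hip)
  -- the deterministic window estimate
  rw [cellInt_eq]
  exact integral_le_of_windows hh hm h0 m0 hhB hmB hA hβ hAm hΔ hΔt hM ha hCw hE hwin

/-! ## Generic pieces of the probabilistic step (used by the last file) -/

/-- DOMINATED CONVERGENCE on `[0, t]` for functions bounded by `1` tending to `0` pointwise. -/
theorem tendsto_setLIntegral_of_le_one {g : ℕ → ℝ → ℝ≥0∞} (hg : ∀ N, Measurable (g N))
    (hg1 : ∀ N t', g N t' ≤ 1) (hlim : ∀ t', Tendsto (fun N => g N t') atTop (𝓝 0)) (t : ℝ) :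
    Tendsto (fun N => ∫⁻ t' in Icc 0 t, g N t') atTop (𝓝 0) := by
  have h := tendsto_lintegral_of_dominated_convergence (μ := volume.restrict (Icc 0 t))
    (F := g) (f := fun _ => 0) (fun _ => 1) hg (fun N => ae_of_all _ fun t' => hg1 N t') ?_
    (ae_of_all _ fun t' => hlim t')
  · simpa only [lintegral_zero] using h
  · rw [setLIntegral_const, one_mul]
    exact measure_Icc_lt_top.ne

/-- MARKOV for the window ipr at a fixed window end (the integrand of H1). -/
theorem measure_ipr_gt_le (Φ : Flows σ) (hG : (Torus.geometry (Fin 3)).IsHardSphereRegular (hsDiameter σ N))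
    (P : Measure (Cfg N)) {ε : ℝ} (hε : 0 < ε) (Δ t' : ℝ) :
    P {z | ε < iprF σ N ((Φ N).flow (t' - Δ) z) Δ} ≤
      (∫⁻ z, ENNReal.ofReal (iprF σ N ((Φ N).flow (t' - Δ) z) Δ) ∂P) / ENNReal.ofReal ε := by
  have hmeas : Measurable fun z : Cfg N => ENNReal.ofReal (iprF σ N ((Φ N).flow (t' - Δ) z) Δ) :=
    ((measurable_iprF hG Δ).comp ((Φ N).measurable_flow (t' - Δ))).ennreal_ofReal
  calc P {z | ε < iprF σ N ((Φ N).flow (t' - Δ) z) Δ}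
      ≤ P {z | ENNReal.ofReal ε ≤ ENNReal.ofReal (iprF σ N ((Φ N).flow (t' - Δ) z) Δ)} :=
        measure_mono fun z hz => ENNReal.ofReal_le_ofReal (le_of_lt hz)
    _ ≤ _ := meas_ge_le_lintegral_div hmeas.aemeasurable (ENNReal.ofReal_pos.2 hε).ne' ENNReal.ofReal_ne_top

/-! ## The choice of the cut-off and of the tail cap -/

/-- A cut-off `V > 0` with `3 β C' ≤ κ/8`. -/
theorem exists_cutoff (K₁ C' : ℝ) {lam κ : ℝ} (hlam : 0 < lam) (hκ : 0 < κ) :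
    ∃ V : ℝ, 0 < V ∧ 3 * cβ K₁ lam V * C' ≤ κ / 8 := by
  have h : Tendsto (fun V : ℝ => 3 * cβ K₁ lam V * C') atTop (𝓝 (3 * 0 * C')) :=
    ((tendsto_cβ K₁ hlam).const_mul 3).mul_const C'
  rw [mul_zero, zero_mul] at h
  obtain ⟨V, hV1, hV2⟩ := (((tendsto_order.1 h).2 (κ / 8) (by positivity)).and (eventually_gt_atTop 0)).exists
  exact ⟨V, hV2, hV1.le⟩

/-- A tail cap `Cw > 0` with `A C'/Cw ≤ κ/8`. -/
theorem exists_tailCap (A C' : ℝ) {κ : ℝ} (hκ : 0 < κ) : ∃ Cw : ℝ, 0 < Cw ∧ A * (C' / Cw) ≤ κ / 8 := by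
  have h : Tendsto (fun Cw : ℝ => A * (C' / Cw)) atTop (𝓝 (A * 0)) :=
    (tendsto_const_nhds.div_atTop tendsto_id).const_mul A
  rw [mul_zero] at h
  obtain ⟨Cw, h1, h2⟩ := (((tendsto_order.1 h).2 (κ / 8) (by positivity)).and (eventually_gt_atTop 0)).exists
  exact ⟨Cw, h2, h1.le⟩

end WindowOfUI

/-! ## Registered anchor -/

/-- Anchor of this helper file (`WindowOfUI.expMoment_flow_le`): along a good orbit of a hard-sphere flow the
exponential velocity moment is bounded by `e^{λ vR(z)²}` (energy conservation). -/
theorem windowOfUI_orbit_anchor : ∀ (σ : ℝ) (N : ℕ) (Φ : Flow σ N) (z : Cfg N), z ∈ Φ.good →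
    ∀ lam : ℝ, 0 ≤ lam → ∀ s : ℝ,
      PastDamping.expMoment lam N (Φ.flow s z) ≤ Real.exp (lam * Reduction.vR z ^ 2) :=
  fun _ _ Φ _ hz _ hlam s => WindowOfUI.expMoment_flow_le Φ hz hlam s

end

end Summit.AtomisticToContinuum.HydrodynamicLimit.Theorems.SustainedAnisotropy
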